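import Literature.IUT.HodgeTheaters.BorelSL2
import HarnessLib

/-!
# [IUTchI] Example 4.3 (i): the `SL`-variants and the natural isomorphism
# `Aut^SL(C_K)/Aut^SL_ε(C_K) ⥲ Aut(C_K)/Aut_ε(C_K) ⥲ F_l^⋇` in matrix form — abc-iut cell, layer L5

Mochizuki, *Inter-universal Teichmüller theory I*, §4 (kurims May-2020 manuscript), Example 4.3 (i) p. 99: after
identifying the images of `Aut_ε(C_K) ⊆ Aut(C_K)` in `Im(G_{F_mod}) ⊆ GL₂(F_l)/{±1}` (`⊇ SL₂(F_l)/{±1}`) with the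
"semi-unipotent, up to `±1`" and "Borel" subgroups `{(* *; 0 ±1)} ⊆ {(* *; 0 *)}`, print continues: "Write
`Aut^SL_ε(C_K) ⊆ Aut_ε(C_K)`, `Aut^SL(C_K) ⊆ Aut(C_K)` for the respective subgroups of elements that act trivially on
the subfield `F(μ_l) ⊆ K` [cf. Remark 3.1.7, (iii)] … one verifies immediately that the subgroup `Aut_ε(C_K) ⊆ Aut(C_K)`
is normal, and that we have natural isomorphisms `Aut^SL(C_K)/Aut^SL_ε(C_K) ⥲ Aut(C_K)/Aut_ε(C_K) ⥲ F_l^⋇`".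

MATRIX FORM, PROVED here (classical finite group theory, independent of the dispute): the GL₂-forms are
`BorelLabels.borel ⊇ BorelLabels.semiUnipPM` with `borelQuotientEquiv : borel/semiUnipPM ≃* F_l^⋇` (this seat,
`BorelLabels.lean`); the SL₂-forms are `SL2.borelSL ⊇ SL2.semiUnipSL` with `SL2.borelSLQuotientEquiv` (abc-iut-L5-t7,
`BorelSL2.lean`, typed for Rmk. 6.12.6 (iv)). This file supplies the link asserted by the displayed "natural
isomorphisms": the inclusion `inclSL : borelSL →* borel` (restriction of `SL₂ → GL₂`), the compatibility of the two label
homomorphisms (`borelLabel_inclSL`), `semiUnipSL = inclSL⁻¹(semiUnipPM)` (`comap_inclSL_semiUnipPM` — the matrix form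
of `Aut^SL_ε = Aut^SL ∩ Aut_ε`), and the bijectivity of the INCLUSION-INDUCED homomorphism of quotients
(`quotientMapSL_bijective`, `quotientEquivSL`), compatible with the two isomorphisms onto `F_l^⋇`
(`borelLabelLift_quotientMapSL`).
NOT asserted here (Galois-theoretic, layers L4/L5-t2): that "acting trivially on `F(μ_l)`" is the determinant-one
condition (the Galois action on `μ_l` is the determinant of the action on `E_F[l]`, via the Weil pairing), and the
identification of `Aut(C_K)` with the Borel subgroup of `Im(G_{F_mod})` itself ([AbsTopIII] Thm. 1.9, Def. 3.1 (c)).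
Record-only; [claim: Mochizuki2012, status: disputed]; nothing here takes a side.
-/

namespace Literature.IUT.HodgeTheaters

open Matrix
open scoped MatrixGroups

namespace BorelLabels

variable (l : ℕ) [Fact l.Prime]

/-- **Example 4.3 (i)**, matrix form of `Aut^SL(C_K) ⊆ Aut(C_K)`: the inclusion of the Borel subgroup of `SL₂(F_l)` into
the Borel subgroup of `GL₂(F_l)` (restriction of `SL₂(F_l) → GL₂(F_l)`; the SL₂ Borel is the pull-back of the GL₂ one,
`SL2.toGL_mem_borel_iff`). [claim: Mochizuki2012, status: disputed] -/
def inclSL : SL2.borelSL l →* borel l :=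
  MonoidHom.codRestrict (Matrix.SpecialLinearGroup.toGL.comp (SL2.borelSL l).subtype) (borel l)
    (fun g => (SL2.toGL_mem_borel_iff l g.1).2 g.2)

/-- The underlying matrix of `inclSL g` is that of `g`. [claim: Mochizuki2012, status: disputed] -/
theorem coe_inclSL (g : SL2.borelSL l) :
    ((inclSL l g : GL2 l) : Matrix (Fin 2) (Fin 2) (ZMod l)) = ((g : SL(2, ZMod l)) : Matrix (Fin 2) (Fin 2) (ZMod l)) :=
  rfl

/-- `inclSL` is injective. [claim: Mochizuki2012, status: disputed] -/
theorem inclSL_injective : Function.Injective (inclSL l) := by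
  intro g h hgh
  have hm := congrArg (fun x : borel l => ((x : GL2 l) : Matrix (Fin 2) (Fin 2) (ZMod l))) hgh
  simp only [coe_inclSL] at hm
  exact Subtype.ext (Matrix.SpecialLinearGroup.ext _ _ fun i j => by rw [hm])

/-- The two label homomorphisms "lower-right entry modulo `±1`" agree along the inclusion: `borelLabel ∘ inclSL =
borelSLLabel`. [claim: Mochizuki2012, status: disputed] -/
theorem borelLabel_inclSL (g : SL2.borelSL l) : borelLabel l (inclSL l g) = SL2.borelSLLabel l g := by
  change FlStar.mk l (isUnit_entry_11 (inclSL l g)).unit = FlStar.mk l (SL2.lowerRightUnit l g)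
  congr 1
  exact Units.ext (by rw [IsUnit.unit_spec]; rfl)

/-- **Example 4.3 (i)**, matrix form of `Aut^SL_ε(C_K) = Aut^SL(C_K) ∩ Aut_ε(C_K)`: the pull-back along `inclSL` of the
semi-unipotent-up-to-`±1` subgroup `{(* *; 0 ±1)}` of the GL₂ Borel is the semi-unipotent subgroup `{(±1 *; 0 ±1)}` of the
SL₂ Borel. [claim: Mochizuki2012, status: disputed] -/
theorem comap_inclSL_semiUnipPM :
    (semiUnipPM l).comap (inclSL l) = (SL2.semiUnipSL l).subgroupOf (SL2.borelSL l) := by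
  rw [← SL2.ker_borelSLLabel, semiUnipPM, ← MonoidHom.comap_bot, ← MonoidHom.comap_bot, Subgroup.comap_comap]
  congr 1
  exact MonoidHom.ext (borelLabel_inclSL l)

/-- **Example 4.3 (i)**: the homomorphism `Aut^SL(C_K)/Aut^SL_ε(C_K) → Aut(C_K)/Aut_ε(C_K)` induced by the inclusion, in
matrix form. [claim: Mochizuki2012, status: disputed] -/
noncomputable def quotientMapSL :
    SL2.borelSL l ⧸ (SL2.semiUnipSL l).subgroupOf (SL2.borelSL l) →* borel l ⧸ semiUnipPM l :=
  QuotientGroup.map _ _ (inclSL l) (by rw [← comap_inclSL_semiUnipPM])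

/-- The induced homomorphism on the class of `g` is the class of `inclSL g`. [claim: Mochizuki2012, status: disputed] -/
theorem quotientMapSL_mk (g : SL2.borelSL l) :
    quotientMapSL l (QuotientGroup.mk g) = QuotientGroup.mk (inclSL l g) :=
  rfl

/-- **Example 4.3 (i)**: "natural isomorphisms `Aut^SL(C_K)/Aut^SL_ε(C_K) ⥲ Aut(C_K)/Aut_ε(C_K)`" — in matrix form the
inclusion-induced homomorphism of quotients is BIJECTIVE (injective: `Aut^SL_ε = Aut^SL ∩ Aut_ε`; surjective: every
label is realised by a determinant-one diagonal element `diag(u⁻¹, u)`, i.e. uses `SL₂(F_l)/{±1} ⊆ Im(G_{F_mod})`).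
[claim: Mochizuki2012, status: disputed] -/
theorem quotientMapSL_bijective : Function.Bijective (quotientMapSL l) := by
  constructor
  · rw [← MonoidHom.ker_eq_bot_iff, Subgroup.eq_bot_iff_forall]
    intro x hx
    induction x using QuotientGroup.induction_on with
    | H g =>
      rw [MonoidHom.mem_ker, quotientMapSL_mk, QuotientGroup.eq_one_iff] at hx
      rw [QuotientGroup.eq_one_iff, ← comap_inclSL_semiUnipPM]
      exact hx
  · intro y
    induction y using QuotientGroup.induction_on with
    | H b =>
      obtain ⟨g, hg⟩ := SL2.borelSLLabel_surjective l (borelLabel l b)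
      refine ⟨QuotientGroup.mk g, ?_⟩
      rw [quotientMapSL_mk, QuotientGroup.eq, semiUnipPM, MonoidHom.mem_ker, map_mul, map_inv,
        borelLabel_inclSL, hg, inv_mul_cancel]

/-- **Example 4.3 (i)**: the natural isomorphism `Aut^SL(C_K)/Aut^SL_ε(C_K) ⥲ Aut(C_K)/Aut_ε(C_K)` in matrix form.
[claim: Mochizuki2012, status: disputed] -/
noncomputable def quotientEquivSL :
    SL2.borelSL l ⧸ (SL2.semiUnipSL l).subgroupOf (SL2.borelSL l) ≃* borel l ⧸ semiUnipPM l :=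
  MulEquiv.ofBijective (quotientMapSL l) (quotientMapSL_bijective l)

/-- Compatibility of the chain "`⥲ Aut(C_K)/Aut_ε(C_K) ⥲ F_l^⋇`": the label of a class is unchanged by the
inclusion-induced map (both quotients map to `F_l^⋇` by "lower-right entry modulo `±1`").
[claim: Mochizuki2012, status: disputed] -/
theorem borelLabelLift_quotientMapSL (x : SL2.borelSL l ⧸ (SL2.semiUnipSL l).subgroupOf (SL2.borelSL l)) :
    QuotientGroup.lift (semiUnipPM l) (borelLabel l) (fun _ h => h) (quotientMapSL l x) =
      QuotientGroup.lift ((SL2.semiUnipSL l).subgroupOf (SL2.borelSL l)) (SL2.borelSLLabel l)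
        (fun g h => by rwa [← SL2.ker_borelSLLabel] at h) x := by
  induction x using QuotientGroup.induction_on with
  | H g => rw [quotientMapSL_mk, QuotientGroup.lift_mk, QuotientGroup.lift_mk, borelLabel_inclSL]

end BorelLabels

end Literature.IUT.HodgeTheaters
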